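import Mathlib

/-!
# Crux `EnsembleRealization` (stmt-AnomalousDissipation-0215) — line `augmented-lift`,
# sub-stub M1 `stub_augCurrent`, piece (M1a)/L4: weak Liouville equation of a divergence-free current

Supports stmt-AnomalousDissipation-0215 (stub `stub_augCurrent` of line `augmented-lift`, piece
M1a `stub_augCurrentLevelPairs`, step (A4) of `augCurrent-notes.md` §3). Nothing here closes an
item. Theorems only.

On the augmented coordinate space `ℝ^D × ℝ` (with any additive Haar measure `μ`): a `C¹`
compactly supported current `J` whose CLASSICAL divergence in the coordinates
`(eⱼ, 0), (0, 1)` vanishes, `Σⱼ ∂_{(eⱼ,0)} Jⱼ + ∂_{(0,1)} J_e = 0`, satisfies the WEAK stationary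
Liouville equation `∫ Dψ(z)[J z] dμ = 0` for every `C¹` test function `ψ` (integration by parts
direction by direction, `integral_mul_fderiv_eq_neg_fderiv_mul_of_integrable`; no decay of `ψ`
is needed since `J` has compact support). Packaged as `stub_augCurrentDivergenceTools`.
-/

noncomputable section

set_option linter.dupNamespace false

open MeasureTheory Set Filter Topology Function Metric
open scoped BigOperators

namespace Summit.AnomalousDissipation.AnomalousDissipation.Theorems.EnsembleRealization

variable {D : ℕ}

/-- Expansion of a vector of `ℝ^D × ℝ` along the coordinate vectors `(eⱼ, 0)` and `(0, 1)`. -/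
theorem eq_sum_smul_single_add_smul (z : EuclideanSpace ℝ (Fin D) × ℝ) :
    z = ∑ j, z.1 j • ((EuclideanSpace.single j (1 : ℝ), (0 : ℝ)) : EuclideanSpace ℝ (Fin D) × ℝ) +
      z.2 • ((0 : EuclideanSpace ℝ (Fin D)), (1 : ℝ)) := by
  ext i
  · simp [Finset.sum_apply, Pi.single_apply, Prod.fst_sum]
  · simp [Prod.snd_sum]

/-- The derivative of a test function against a current, expanded in coordinates:
`Dψ(z)[J z] = Σⱼ Jⱼ(z) ∂_{(eⱼ,0)}ψ(z) + J_e(z) ∂_{(0,1)}ψ(z)`. -/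
theorem fderiv_apply_current_eq_sum (ψ : EuclideanSpace ℝ (Fin D) × ℝ → ℝ)
    (J : EuclideanSpace ℝ (Fin D) × ℝ → EuclideanSpace ℝ (Fin D) × ℝ) (z : EuclideanSpace ℝ (Fin D) × ℝ) :
    fderiv ℝ ψ z (J z) = ∑ j, (J z).1 j * fderiv ℝ ψ z (EuclideanSpace.single j 1, 0) +
      (J z).2 * fderiv ℝ ψ z (0, 1) := by
  conv_lhs => rw [eq_sum_smul_single_add_smul (J z)]
  simp only [map_add, map_sum, map_smul, smul_eq_mul]

/-- Products of a continuous compactly supported function with a continuous function are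
integrable (any locally finite measure). -/
theorem integrable_mul_of_hasCompactSupport {μ : Measure (EuclideanSpace ℝ (Fin D) × ℝ)}
    [IsLocallyFiniteMeasure μ] {u v : EuclideanSpace ℝ (Fin D) × ℝ → ℝ} (hu : Continuous u)
    (huc : HasCompactSupport u) (hv : Continuous v) : Integrable (fun z => u z * v z) μ :=
  (hu.mul hv).integrable_of_hasCompactSupport (huc.mul_right)

/-- **Divergence tools for (M1a).** Let `μ` be an additive Haar measure on `ℝ^D × ℝ`, `J` a `C¹`
compactly supported current with vanishing classical divergence
`Σⱼ D(Jⱼ)(z)(eⱼ, 0) + D(J_e)(z)(0, 1) = 0`, and `ψ` a `C¹` function. Then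
`∫ Dψ(z)[J z] dμ = 0` (the weak stationary Liouville equation of the current). -/
theorem stub_augCurrentDivergenceTools {D : ℕ} (μ : Measure (EuclideanSpace ℝ (Fin D) × ℝ)) [μ.IsAddHaarMeasure]
    {J : EuclideanSpace ℝ (Fin D) × ℝ → EuclideanSpace ℝ (Fin D) × ℝ} (hJ : ContDiff ℝ 1 J)
    (hJc : HasCompactSupport J)
    (hdiv : ∀ z, ∑ j, fderiv ℝ (fun z => (J z).1 j) z (EuclideanSpace.single j 1, 0) +
      fderiv ℝ (fun z => (J z).2) z (0, 1) = 0)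
    {ψ : EuclideanSpace ℝ (Fin D) × ℝ → ℝ} (hψ : ContDiff ℝ 1 ψ) :
    ∫ z, fderiv ℝ ψ z (J z) ∂μ = 0 := by
  -- the coordinate functions of the current
  have hJ1 : ∀ j, ContDiff ℝ 1 fun z => (J z).1 j := fun j =>
    (EuclideanSpace.proj (𝕜 := ℝ) j).contDiff.comp (contDiff_fst.comp hJ)
  have hJ2 : ContDiff ℝ 1 fun z => (J z).2 := contDiff_snd.comp hJ
  have hJ1c : ∀ j, HasCompactSupport fun z => (J z).1 j := fun j =>
    hJc.comp_left (g := fun v : EuclideanSpace ℝ (Fin D) × ℝ => v.1 j) (by simp)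
  have hJ2c : HasCompactSupport fun z => (J z).2 := hJc.comp_left (g := fun v : EuclideanSpace ℝ (Fin D) × ℝ => v.2) rfl
  have hψd : Differentiable ℝ ψ := hψ.differentiable one_ne_zero
  have hψc' : ∀ v, Continuous fun z => fderiv ℝ ψ z v := fun v =>
    (hψ.continuous_fderiv one_ne_zero).clm_apply continuous_const
  have hd1 : ∀ j, Differentiable ℝ fun z => (J z).1 j := fun j => (hJ1 j).differentiable one_ne_zero
  have hd2 : Differentiable ℝ fun z => (J z).2 := hJ2.differentiable one_ne_zero
  have hc1' : ∀ j v, Continuous fun z => fderiv ℝ (fun z => (J z).1 j) z v := fun j v =>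
    ((hJ1 j).continuous_fderiv one_ne_zero).clm_apply continuous_const
  have hc2' : ∀ v, Continuous fun z => fderiv ℝ (fun z => (J z).2) z v := fun v =>
    (hJ2.continuous_fderiv one_ne_zero).clm_apply continuous_const
  -- integration by parts, direction by direction
  have hibp1 : ∀ j, ∫ z, (J z).1 j * fderiv ℝ ψ z (EuclideanSpace.single j 1, 0) ∂μ =
      -∫ z, fderiv ℝ (fun z => (J z).1 j) z (EuclideanSpace.single j 1, 0) * ψ z ∂μ := fun j =>
    integral_mul_fderiv_eq_neg_fderiv_mul_of_integrable
      (integrable_mul_of_hasCompactSupport (hc1' j _) ((hJ1c j).fderiv_apply (𝕜 := ℝ) _) hψ.continuous)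
      (integrable_mul_of_hasCompactSupport (hJ1 j).continuous (hJ1c j) (hψc' _))
      (integrable_mul_of_hasCompactSupport (hJ1 j).continuous (hJ1c j) hψ.continuous)
      (fun z _ => hd1 j z) (fun z _ => hψd z)
  have hibp2 : ∫ z, (J z).2 * fderiv ℝ ψ z (0, 1) ∂μ = -∫ z, fderiv ℝ (fun z => (J z).2) z (0, 1) * ψ z ∂μ :=
    integral_mul_fderiv_eq_neg_fderiv_mul_of_integrable
      (integrable_mul_of_hasCompactSupport (hc2' _) (hJ2c.fderiv_apply (𝕜 := ℝ) _) hψ.continuous)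
      (integrable_mul_of_hasCompactSupport hJ2.continuous hJ2c (hψc' _))
      (integrable_mul_of_hasCompactSupport hJ2.continuous hJ2c hψ.continuous)
      (fun z _ => hd2 z) (fun z _ => hψd z)
  -- assemble
  have hint1 : ∀ j, Integrable (fun z => (J z).1 j * fderiv ℝ ψ z (EuclideanSpace.single j 1, 0)) μ :=
    fun j => integrable_mul_of_hasCompactSupport (hJ1 j).continuous (hJ1c j) (hψc' _)
  have hint2 : Integrable (fun z => (J z).2 * fderiv ℝ ψ z (0, 1)) μ :=
    integrable_mul_of_hasCompactSupport hJ2.continuous hJ2c (hψc' _)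
  have hint1' : ∀ j, Integrable (fun z => fderiv ℝ (fun z => (J z).1 j) z (EuclideanSpace.single j 1, 0) * ψ z) μ :=
    fun j => integrable_mul_of_hasCompactSupport (hc1' j _) ((hJ1c j).fderiv_apply (𝕜 := ℝ) _) hψ.continuous
  have hint2' : Integrable (fun z => fderiv ℝ (fun z => (J z).2) z (0, 1) * ψ z) μ :=
    integrable_mul_of_hasCompactSupport (hc2' _) (hJ2c.fderiv_apply (𝕜 := ℝ) _) hψ.continuous
  simp_rw [fderiv_apply_current_eq_sum ψ J]
  rw [integral_add (integrable_finsetSum _ fun j _ => hint1 j) hint2,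
    integral_finsetSum _ fun j _ => hint1 j, hibp2]
  simp_rw [hibp1]
  rw [Finset.sum_neg_distrib, ← integral_finsetSum _ fun j _ => hint1' j, ← neg_add,
    ← integral_add (integrable_finsetSum _ fun j _ => hint1' j) hint2', neg_eq_zero]
  refine integral_eq_zero_of_ae (Eventually.of_forall fun z => ?_)
  have h := congrArg (· * ψ z) (hdiv z)
  simp only [zero_mul, add_mul, Finset.sum_mul] at h
  simpa using h

end Summit.AnomalousDissipation.AnomalousDissipation.Theorems.EnsembleRealization
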